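import Literature.Barriers.CriticalPhenomena.PositionSpaceRGNonGibbsianUnfixing
import Literature.Probability.LatticeModels.IsingFieldVolume
import HarnessLib

/-!
# van Enter–Fernández–Sokal 1993, §4.3.1: the internal-spin system of the `b = 2` decimation as
# an Ising model with a site-dependent field on the diluted lattice `ℤ^d ∖ 2ℤ^d`

Fifth companion file of `Literature/Barriers/CriticalPhenomena/PositionSpaceRGNonGibbsian.lean`
(Theorem 4.2 line; remaining named fact `VEFS1993_eq412` of `…Unfixing.lean`). The two
expectations of `VEFS1993_eq412` are finite-volume Ising expectations on `ℤ^d` in a volume of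
INTERNAL sites (off the decimated sublattice `2ℤ^d`) with the decimated spins frozen by the
boundary condition. Here this "modified object system" (§4.1.2 Step 0/1: "the system in
`(ℤ²)_int` with all image spins set to fixed values"; §4.3.1 Step 1: "an internal spin with all
but one of its coordinates even — that is, one which is adjacent to two image spins — … while
all other internal spins are unaffected") is identified with the tree's Ising model with a
SITE-DEPENDENT field (`fieldExpect`, `IsingFieldModel`) on the diluted graph: the field at an
internal site is the sum of its frozen decimated neighbours (`decField`), and for the fully
alternating image configuration these fields cancel ("each internal spin is adjacent either to
two image spins of opposite sign — in which case the effective magnetic fields cancel — or else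
to no image spin", §4.1.2 Step 1).

## What is formalised (namespace `Literature.Barriers.CriticalPhenomena.NonGibbs`), all proved

* `IsDecimatedSite d x` (all coordinates even), `dilutedGraph d` (the nearest-neighbour graph of
  `ℤ^d` restricted to internal sites; decimated sites isolated), `decNbrs d k` (the decimated
  neighbours of `k` in `ℤ^d`), `decField d ξ k = ∑_{a ∈ decNbrs k} ξ_a`.
* **The bridge** `isingExpect_fixed_eq_fieldExpect_diluted`: for a volume `Λ` of internal sites
  and any frozen configuration `ξ`,
  `⟨f⟩^{ξ}_{ℤ^d;Λ;β,0} = ⟨f⟩^{ξ}_{dilutedGraph;Λ;β,decField ξ}` (the Hamiltonians coincide: the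
  bonds of `ℤ^d` at `Λ` are the internal bonds plus the bonds to decimated sites, which are field
  terms).
* **Geometry of the decimated neighbours**: an internal site has either no decimated neighbour
  or exactly the two `k ± eᵢ` along its unique odd coordinate (`decNbrs_eq_empty_or_pair`), whose
  halves are adjacent image sites; the alternating configuration takes opposite values on
  adjacent image sites (`altConfig_add_single`), so the alternating fields cancel.
* **Locality of the boundary condition** for the field model on a general graph
  (`fieldExpect_fixed_congr_outerBoundary`, the field-model twin of the tree's
  `isingExpect_fixed_congr_outerBoundary`).
* **The neutralised field** `neutralField d R` (footnote 48: "we replace these fields by zero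
  anyway"): `2` at internal sites whose two decimated neighbours both have their image site
  outside `Λ'_R`, `0` elsewhere; it is dominated by the fields of BOTH extremal boundary
  conditions of `VEFS1993_eq412` (`neutralField_le_decField_plus/minus`: the alternating core
  fields cancel, the interface fields are `≥ 0`, the annulus fields are `2`), and both extremal
  conditions are `-1` on internal sites; hence, by the FKG monotonicity in the field,
  `eq412_gap_ge_neutral`: the gap `y - x` of `VEFS1993_eq412` is at least
  `⟨e^{2β∑_{y∼0}σ_y} - e^{-2β∑_{y∼0}σ_y}⟩^{-}_{dilutedGraph; Λ^int_{R'}; β, h⁰_R}` — ONE finite-volume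
  system (internal spins with the neutralised nonnegative field and `-` boundary condition).
-/

noncomputable section

namespace Literature.Barriers.CriticalPhenomena.NonGibbs

open MeasureTheory Finset Literature.Probability.LatticeModels

variable (d : ℕ)

/-! ### Decimated sites and the diluted graph -/

/-- A site of `ℤ^d` is **decimated** (an image site of the `b = 2` decimation, §3.1.2 eq. (3.7))
if all its coordinates are even. [cite: VanenterFernandezSokal1993, §3.1.2 eq. (3.7)] -/
def IsDecimatedSite (x : Site d) : Prop := ∀ i, (2 : ℤ) ∣ x i

/-- Being decimated is decidable. [folklore] -/
instance (x : Site d) : Decidable (IsDecimatedSite d x) :=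
  inferInstanceAs (Decidable (∀ i, (2 : ℤ) ∣ x i))

/-- **The internal-spin graph** of the `b = 2` decimation (§4.3.1 Step 1: the "periodically
diluted" lattice): the nearest-neighbour graph of `ℤ^d` restricted to the internal
(non-decimated) sites; decimated sites are isolated vertices.
[cite: VanenterFernandezSokal1993, §4.3.1 Step 1] -/
def dilutedGraph : SimpleGraph (Site d) where
  Adj x y := (zdGraph d).Adj x y ∧ ¬ IsDecimatedSite d x ∧ ¬ IsDecimatedSite d y
  symm := ⟨fun _ _ h => ⟨h.1.symm, h.2.2, h.2.1⟩⟩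
  loopless := ⟨fun _ h => h.1.ne rfl⟩

/-- Adjacency in the diluted graph is decidable. [folklore] -/
instance : DecidableRel (dilutedGraph d).Adj := fun x y =>
  inferInstanceAs (Decidable ((zdGraph d).Adj x y ∧ ¬ IsDecimatedSite d x ∧ ¬ IsDecimatedSite d y))

/-- The diluted graph is a subgraph of `ℤ^d`. [cite: VanenterFernandezSokal1993, §4.3.1 Step 1] -/
theorem dilutedGraph_le : dilutedGraph d ≤ zdGraph d := fun _ _ h => h.1

/-- The diluted graph is locally finite (its neighbourhoods are those of `ℤ^d`, filtered).
[cite: VanenterFernandezSokal1993, §4.3.1 Step 1] -/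
instance : (dilutedGraph d).LocallyFinite := fun x =>
  Fintype.ofFinset (((zdGraph d).neighborFinset x).filter fun y =>
      ¬ IsDecimatedSite d x ∧ ¬ IsDecimatedSite d y)
    (by
      intro y
      simp only [Finset.mem_filter, SimpleGraph.mem_neighborFinset, SimpleGraph.mem_neighborSet]
      rfl)

/-- Adjacency in the diluted graph. [cite: VanenterFernandezSokal1993, §4.3.1 Step 1] -/
theorem dilutedGraph_adj {x y : Site d} :
    (dilutedGraph d).Adj x y ↔ (zdGraph d).Adj x y ∧ ¬ IsDecimatedSite d x ∧ ¬ IsDecimatedSite d y :=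
  Iff.rfl

/-- **The decimated neighbours** of a site in `ℤ^d` (the image spins an internal spin is coupled
to). [cite: VanenterFernandezSokal1993, §4.3.1 Step 1] -/
def decNbrs (k : Site d) : Finset (Site d) :=
  ((zdGraph d).neighborFinset k).filter (IsDecimatedSite d)

/-- Membership in `decNbrs`. [cite: VanenterFernandezSokal1993, §4.3.1 Step 1] -/
theorem mem_decNbrs {k a : Site d} : a ∈ decNbrs d k ↔ (zdGraph d).Adj k a ∧ IsDecimatedSite d a := by
  simp [decNbrs]

/-- **The field induced on a site by the frozen decimated spins** `ξ`:
`h^ξ_k = ∑_{a ∼ k, a ∈ 2ℤ^d} ξ_a` ("each internal spin … feels an 'effective magnetic field' `±J`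
from each image spin adjacent to it", §4.1.2 Step 2). [cite: VanenterFernandezSokal1993, §4.1.2 Step 2] -/
def decField (ξ : SpinConfig (Site d)) (k : Site d) : ℝ :=
  ∑ a ∈ decNbrs d k, spinAt a ξ

variable {d}

/-! ### The bridge: frozen decimated spins are a site-dependent field on the diluted graph -/

open Classical in
/-- The internal bonds at an internal volume: the edges of the diluted graph touching `Λ` are the
edges of `ℤ^d` touching `Λ` with no decimated endpoint.
[cite: VanenterFernandezSokal1993, §4.3.1 Step 1] -/
theorem edgesTouching_dilutedGraph {Λ : Finset (Site d)} :
    edgesTouching (dilutedGraph d) Λ =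
      (edgesTouching (zdGraph d) Λ).filter fun e => ∀ z ∈ e, ¬ IsDecimatedSite d z := by
  ext e
  rw [Finset.mem_filter, mem_edgesTouching_iff, mem_edgesTouching_iff]
  induction e using Sym2.ind with
  | _ u v =>
    simp only [SimpleGraph.mem_edgeSet, dilutedGraph_adj, Sym2.mem_iff, forall_eq_or_imp,
      forall_eq]
    exact ⟨fun ⟨⟨h1, h2, h3⟩, hx⟩ => ⟨⟨h1, hx⟩, h2, h3⟩, fun ⟨⟨h1, hx⟩, h2, h3⟩ => ⟨⟨h1, h2, h3⟩, hx⟩⟩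

open Classical in
/-- The bonds of `ℤ^d` at an internal volume with a decimated endpoint are the pairs
`{k, a}`, `k ∈ Λ`, `a ∈ decNbrs k` (each exactly once).
[cite: VanenterFernandezSokal1993, §4.3.1 Step 1] -/
theorem edgesTouching_filter_dec_eq_biUnion {Λ : Finset (Site d)}
    (hΛ : ∀ x ∈ Λ, ¬ IsDecimatedSite d x) :
    (edgesTouching (zdGraph d) Λ).filter (fun e => ∃ z ∈ e, IsDecimatedSite d z) =
      Λ.biUnion fun k => (decNbrs d k).image fun a => s(k, a) := by
  ext e
  rw [Finset.mem_filter, mem_edgesTouching_iff, Finset.mem_biUnion]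
  constructor
  · rintro ⟨⟨he, x, hx, hxe⟩, z, hze, hz⟩
    induction e using Sym2.ind with
    | _ u v =>
      have hadj : (zdGraph d).Adj u v := by simpa using he
      rcases Sym2.mem_iff.1 hxe with rfl | rfl
      · -- `x = u`; the decimated endpoint must be `v`
        rcases Sym2.mem_iff.1 hze with rfl | rfl
        · exact absurd hz (hΛ _ hx)
        · exact ⟨x, hx, Finset.mem_image.2 ⟨z, (mem_decNbrs d).2 ⟨hadj, hz⟩, rfl⟩⟩
      · rcases Sym2.mem_iff.1 hze with rfl | rfl
        · exact ⟨x, hx, Finset.mem_image.2 ⟨z, (mem_decNbrs d).2 ⟨hadj.symm, hz⟩, Sym2.eq_swap⟩⟩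
        · exact absurd hz (hΛ _ hx)
  · rintro ⟨k, hk, hke⟩
    obtain ⟨a, ha, rfl⟩ := Finset.mem_image.1 hke
    obtain ⟨hadj, hdec⟩ := (mem_decNbrs d).1 ha
    exact ⟨⟨by simpa using hadj, k, hk, Sym2.mem_mk_left _ _⟩, a, Sym2.mem_mk_right _ _, hdec⟩

open Classical in
/-- **The bonds to the decimated sites are field terms**: on a configuration equal to `ξ` off the
internal volume `Λ`, `∑_{e at Λ with a decimated end} σ_e = ∑_{k ∈ Λ} h^ξ_k σ_k`.
[cite: VanenterFernandezSokal1993, §4.1.2 Step 2 and §4.3.1 Step 1] -/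
theorem sum_bondSpin_dec_eq {Λ : Finset (Site d)} (hΛ : ∀ x ∈ Λ, ¬ IsDecimatedSite d x)
    (ξ σ : SpinConfig (Site d)) (hσ : ∀ x, x ∉ Λ → σ x = ξ x) :
    ∑ e ∈ (edgesTouching (zdGraph d) Λ).filter (fun e => ∃ z ∈ e, IsDecimatedSite d z), bondSpin σ e =
      ∑ k ∈ Λ, decField d ξ k * spinAt k σ := by
  rw [edgesTouching_filter_dec_eq_biUnion hΛ, Finset.sum_biUnion]
  · refine Finset.sum_congr rfl fun k hk => ?_
    rw [Finset.sum_image, decField, Finset.sum_mul]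
    · refine Finset.sum_congr rfl fun a ha => ?_
      obtain ⟨_, hdec⟩ := (mem_decNbrs d).1 ha
      have haΛ : a ∉ Λ := fun h => hΛ a h hdec
      rw [bondSpin_mk, spinAt, spinAt, spinAt, hσ a haΛ]
      ring
    · intro a _ a' _ h
      exact Sym2.congr_right.1 h
  · -- the families of bonds at distinct internal sites are disjoint
    intro k hk k' hk' hne
    simp only [Function.onFun]
    rw [Finset.disjoint_left]
    intro e he he'
    obtain ⟨a, ha, rfl⟩ := Finset.mem_image.1 he
    obtain ⟨a', ha', h⟩ := Finset.mem_image.1 he'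
    have hdec' := ((mem_decNbrs d).1 ha').2
    rcases Sym2.eq_iff.1 h with ⟨h1, _⟩ | ⟨_, h2⟩
    · exact hne h1.symm
    · exact hΛ k (Finset.mem_coe.1 hk) (h2 ▸ hdec')

/-- **The Hamiltonians coincide**: for an internal volume `Λ` and `σ = ξ` off `Λ`,
`ℋ^{ξ}_{ℤ^d;Λ;0}(σ) = ℋ^{ξ}_{dilutedGraph;Λ;h^ξ}(σ)` — the zero-field Hamiltonian of `ℤ^d` with the
decimated spins frozen is the Hamiltonian of the internal system with the site-dependent field
`h^ξ`. [cite: VanenterFernandezSokal1993, §4.1.2 Steps 0–2 and §4.3.1 Step 1] -/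
theorem isingHamiltonian_zd_eq_fieldHamiltonian_diluted {Λ : Finset (Site d)}
    (hΛ : ∀ x ∈ Λ, ¬ IsDecimatedSite d x) (ξ σ : SpinConfig (Site d))
    (hσ : ∀ x, x ∉ Λ → σ x = ξ x) :
    isingHamiltonian (zdGraph d) Λ 0 (.fixed ξ) σ =
      fieldHamiltonian (dilutedGraph d) Λ (decField d ξ) (.fixed ξ) σ := by
  classical
  simp only [isingHamiltonian, fieldHamiltonian, interactionEdges_fixed, zero_mul, sub_zero]
  rw [← Finset.sum_filter_add_sum_filter_not (edgesTouching (zdGraph d) Λ)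
    (fun e => ∃ z ∈ e, IsDecimatedSite d z), sum_bondSpin_dec_eq hΛ ξ σ hσ,
    edgesTouching_dilutedGraph]
  have hfilt : (edgesTouching (zdGraph d) Λ).filter (fun e => ¬ ∃ z ∈ e, IsDecimatedSite d z) =
      (edgesTouching (zdGraph d) Λ).filter (fun e => ∀ z ∈ e, ¬ IsDecimatedSite d z) :=
    Finset.filter_congr fun e _ => by push Not; exact Iff.rfl
  rw [hfilt]
  ring

/-- **The bridge** (the "modified object system" of §4.1.2/§4.3.1 as the tree's
site-dependent-field model): for a volume `Λ` of internal sites and any frozen configuration `ξ`,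
the zero-field Ising expectation on `ℤ^d` with boundary condition `ξ` equals the expectation of
the diluted-graph model with field `h^ξ = decField ξ` and boundary condition `ξ`:
`⟨f⟩^{ξ}_{ℤ^d;Λ;β,0} = ⟨f⟩^{ξ}_{dilutedGraph;Λ;β,h^ξ}`.
[cite: VanenterFernandezSokal1993, §4.1.2 Steps 0–2 and §4.3.1 Step 1] -/
theorem isingExpect_fixed_eq_fieldExpect_diluted {Λ : Finset (Site d)}
    (hΛ : ∀ x ∈ Λ, ¬ IsDecimatedSite d x) (β : ℝ) (ξ : SpinConfig (Site d))
    {f : SpinConfig (Site d) → ℝ} (hf : Measurable f) :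
    isingExpect (zdGraph d) Λ β 0 (.fixed ξ) f =
      fieldExpect (dilutedGraph d) Λ β (decField d ξ) (.fixed ξ) f := by
  have hw : ∀ τ : Λ → ℤˣ, isingWeight (zdGraph d) Λ β 0 (.fixed ξ) τ =
      fieldWeight (dilutedGraph d) Λ β (decField d ξ) (.fixed ξ) τ := fun τ => by
    rw [isingWeight, fieldWeight, isingHamiltonian_zd_eq_fieldHamiltonian_diluted hΛ ξ _
      (fun x hx => by rw [glue_apply_of_notMem _ _ _ hx]; rfl)]
  rw [isingExpect, integral_isingMeasure _ Λ β 0 _ hf, fieldExpect_eq_sum_div _ Λ β _ _ hf]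
  simp only [isingPartitionFunction, fieldZ, hw]

/-! ### Geometry of the decimated neighbours -/

/-- The origin is decimated. [cite: VanenterFernandezSokal1993, §3.1.2 eq. (3.7)] -/
theorem isDecimatedSite_zero : IsDecimatedSite d 0 := fun i => by simp

/-- `2x` is decimated. [cite: VanenterFernandezSokal1993, §3.1.2 eq. (3.7)] -/
theorem isDecimatedSite_double (x : Site d) : IsDecimatedSite d fun i => ((2 : ℕ) : ℤ) * x i :=
  fun i => ⟨x i, by simp⟩

/-- A decimated site is twice its half. [cite: VanenterFernandezSokal1993, §3.1.2 eq. (3.7)] -/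
theorem double_ediv_of_isDecimatedSite {a : Site d} (ha : IsDecimatedSite d a) :
    (fun i => ((2 : ℕ) : ℤ) * (a i / 2)) = a := by
  funext i
  simp only [Nat.cast_ofNat]
  exact Int.mul_ediv_cancel' (ha i)

/-- The internal volume of Steps 2–3 consists of internal sites.
[cite: VanenterFernandezSokal1993, §4.3.1 Step 2] -/
theorem not_isDecimatedSite_of_mem_gpiVolume' {R' : ℕ} {x : Site d} (hx : x ∈ gpiVolume' d R') :
    ¬ IsDecimatedSite d x :=
  (Finset.mem_filter.1 hx).2

/-- Sites of the internal volume lie in the cube `box d (2R')`. [cite: VanenterFernandezSokal1993, §4.3.1 Step 2] -/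
theorem mem_box_of_mem_gpiVolume' {R' : ℕ} {x : Site d} (hx : x ∈ gpiVolume' d R') :
    x ∈ box d (2 * R') :=
  (Finset.mem_filter.1 hx).1

/-- **The alternating configuration flips along a unit step**: `ω'_alt(y + eᵢ) = -ω'_alt(y)`
(adjacent image sites carry opposite image spins, eq. (4.2)). [cite: VanenterFernandezSokal1993, eq. (4.2)] -/
theorem altConfig_add_single (y : Site d) (i : Fin d) :
    altConfig d (y + Pi.single i 1) = -altConfig d y := by
  simp only [altConfig, Pi.add_apply]
  rw [Finset.sum_add_distrib, Finset.sum_pi_single']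
  simp only [Finset.mem_univ, if_true]
  rw [uzpow_add, uzpow_one, mul_neg_one]

/-- **The decimated neighbours of an internal site**: either none, or exactly the two sites
`k - eᵢ`, `k + eᵢ` along a coordinate `i` (the unique odd coordinate of `k`), both decimated
(§4.3.1 Step 1: "an internal spin with all but one of its coordinates even — that is, one which
is adjacent to two image spins"; all other internal spins have no image neighbour).
[cite: VanenterFernandezSokal1993, §4.3.1 Step 1] -/
theorem decNbrs_eq_empty_or_pair {k : Site d} (hk : ¬ IsDecimatedSite d k) :
    decNbrs d k = ∅ ∨ ∃ i : Fin d, IsDecimatedSite d (k - Pi.single i 1) ∧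
      IsDecimatedSite d (k + Pi.single i 1) ∧
      decNbrs d k = {k - Pi.single i 1, k + Pi.single i 1} := by
  classical
  by_cases hne : decNbrs d k = ∅
  · exact Or.inl hne
  right
  obtain ⟨a, ha⟩ := Finset.nonempty_iff_ne_empty.2 hne
  obtain ⟨hadj, hdec⟩ := (mem_decNbrs d).1 ha
  obtain ⟨i, hi⟩ := (zdGraph_adj_iff k a).1 hadj
  -- along `i`, `k` is odd; all other coordinates of `k` are even
  have hcoord : ∀ j, j ≠ i → (2 : ℤ) ∣ k j := by
    intro j hj
    rcases hi with h | h
    · have := congrFun h j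
      simp only [Pi.add_apply, Pi.single_eq_of_ne hj, add_zero] at this
      rw [← this]; exact hdec j
    · have := congrFun h j
      simp only [Pi.add_apply, Pi.single_eq_of_ne hj, add_zero] at this
      rw [this]; exact hdec j
  have hodd : ¬ (2 : ℤ) ∣ k i := by
    intro h2
    exact hk fun j => if hj : j = i then hj ▸ h2 else hcoord j hj
  have hdm : IsDecimatedSite d (k - Pi.single i 1) := by
    intro j
    by_cases hj : j = i
    · subst hj
      simp only [Pi.sub_apply, Pi.single_eq_same]
      rcases hi with h | h
      · have := congrFun h j
        simp only [Pi.add_apply, Pi.single_eq_same] at this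
        -- `a j = k j + 1` is even, so `k j - 1` is even
        have h2 := hdec j
        rw [this] at h2
        have : k j - 1 = (k j + 1) - 2 := by ring
        rw [this]; exact dvd_sub h2 (dvd_refl 2)
      · have := congrFun h j
        simp only [Pi.add_apply, Pi.single_eq_same] at this
        have h2 := hdec j
        have : k j - 1 = a j := by rw [this]; ring
        rw [this]; exact h2
    · simp only [Pi.sub_apply, Pi.single_eq_of_ne hj, sub_zero]; exact hcoord j hj
  have hdp : IsDecimatedSite d (k + Pi.single i 1) := by
    intro j
    by_cases hj : j = i
    · subst hj
      simp only [Pi.add_apply, Pi.single_eq_same]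
      have := hdm j
      simp only [Pi.sub_apply, Pi.single_eq_same] at this
      have h' : k j + 1 = (k j - 1) + 2 := by ring
      rw [h']; exact dvd_add this (dvd_refl 2)
    · simp only [Pi.add_apply, Pi.single_eq_of_ne hj, add_zero]; exact hcoord j hj
  refine ⟨i, hdm, hdp, ?_⟩
  ext b
  rw [mem_decNbrs, Finset.mem_insert, Finset.mem_singleton]
  constructor
  · rintro ⟨hb, hbdec⟩
    obtain ⟨j, hj⟩ := (zdGraph_adj_iff k b).1 hb
    -- the step must be along `i`
    have hji : j = i := by
      by_contra hji
      have hbi : b i = k i := by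
        rcases hj with h | h
        · have := congrFun h i; simp only [Pi.add_apply, Pi.single_eq_of_ne (Ne.symm hji) , add_zero] at this
          exact this
        · have := congrFun h i; simp only [Pi.add_apply, Pi.single_eq_of_ne (Ne.symm hji), add_zero] at this
          exact this.symm
      exact hodd (hbi ▸ hbdec i)
    subst hji
    rcases hj with h | h
    · exact Or.inr h
    · left
      rw [h]; funext l; simp
  · rintro (rfl | rfl)
    · refine ⟨(zdGraph_adj_iff _ _).2 ⟨i, Or.inr ?_⟩, hdm⟩
      funext l; simp
    · exact ⟨(zdGraph_adj_iff _ _).2 ⟨i, Or.inl rfl⟩, hdp⟩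

/-- The two decimated neighbours are distinct. [folklore] -/
theorem sub_single_ne_add_single (k : Site d) (i : Fin d) :
    k - Pi.single i 1 ≠ k + Pi.single i 1 := by
  intro h
  have := congrFun h i
  simp at this
  omega

/-- **The field of frozen decimated spins at an internal site**: `0` if it has no decimated
neighbour, `ξ(k-eᵢ) + ξ(k+eᵢ)` otherwise. [cite: VanenterFernandezSokal1993, §4.3.1 Step 1] -/
theorem decField_eq_zero_or_pair (ξ : SpinConfig (Site d)) {k : Site d} (hk : ¬ IsDecimatedSite d k) :
    decField d ξ k = 0 ∨ ∃ i : Fin d, IsDecimatedSite d (k - Pi.single i 1) ∧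
      IsDecimatedSite d (k + Pi.single i 1) ∧
      decField d ξ k = spinAt (k - Pi.single i 1) ξ + spinAt (k + Pi.single i 1) ξ := by
  rcases decNbrs_eq_empty_or_pair hk with h | ⟨i, hdm, hdp, h⟩
  · left; simp [decField, h]
  · right
    refine ⟨i, hdm, hdp, ?_⟩
    rw [decField, h, Finset.sum_pair (sub_single_ne_add_single k i)]

/-- The halves of the two decimated neighbours are adjacent image sites:
`(k+eᵢ)/2 = (k-eᵢ)/2 + eᵢ`. [cite: VanenterFernandezSokal1993, §4.3.1 Step 1] -/
theorem ediv_add_single {k : Site d} {i : Fin d} (hdm : IsDecimatedSite d (k - Pi.single i 1)) :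
    (fun j => (k + Pi.single i 1 : Site d) j / 2) =
      (fun j => (k - Pi.single i 1 : Site d) j / 2) + Pi.single i 1 := by
  funext j
  by_cases hj : j = i
  · subst hj
    simp only [Pi.add_apply, Pi.single_eq_same, Pi.sub_apply]
    obtain ⟨m, hm⟩ := hdm j
    simp only [Pi.sub_apply, Pi.single_eq_same] at hm
    have hk : k j = 2 * m + 1 := by linarith
    rw [hk]
    have e1 : (2 * m + 1 + 1 : ℤ) = 2 * (m + 1) := by ring
    have e2 : (2 * m + 1 - 1 : ℤ) = 2 * m := by ring
    rw [e1, e2, Int.mul_ediv_cancel_left _ two_ne_zero, Int.mul_ediv_cancel_left _ two_ne_zero]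
  · simp [Pi.single_eq_of_ne hj]

/-! ### Locality of the boundary condition (general graphs) -/

section Locality

variable {W : Type*} (G' : SimpleGraph W) [DecidableEq W] [G'.LocallyFinite]

/-- The weight `w^η_{Λ;h}(τ)` of the site-dependent-field model depends on `η` only through its
values on the outer boundary `∂ᵉˣΛ` (Friedli–Velenik 2017, §3.6.3, remark after eq. (3.26)), as
the tree's `isingWeight_fixed_congr_outerBoundary`. [cite: FriedliVelenik2017, §3.6.3, eq. (3.26)] -/
theorem _root_.Literature.Probability.LatticeModels.fieldWeight_fixed_congr_outerBoundary
    {Λ : Finset W} {η η' : SpinConfig W} (hη : ∀ y ∈ outerBoundary G' Λ, η y = η' y) (β : ℝ)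
    (h : W → ℝ) (τ : Λ → ℤˣ) :
    fieldWeight G' Λ β h (.fixed η) τ = fieldWeight G' Λ β h (.fixed η') τ := by
  have hin : ∀ x ∈ Λ, glue Λ τ (.fixed η) x = glue Λ τ (.fixed η') x := fun x hx => by
    rw [glue_apply_of_mem _ _ _ hx, glue_apply_of_mem _ _ _ hx]
  have hbd : ∀ y ∈ outerBoundary G' Λ, glue Λ τ (.fixed η) y = glue Λ τ (.fixed η') y := by
    intro y hy
    have hyΛ : y ∉ Λ := (mem_outerBoundary_iff.1 hy).1
    rw [glue_apply_of_notMem _ _ _ hyΛ, glue_apply_of_notMem _ _ _ hyΛ,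
      BoundaryCondition.outside_fixed, BoundaryCondition.outside_fixed, hη y hy]
  have hpt : ∀ e ∈ edgesTouching G' Λ, ∀ z ∈ e,
      glue Λ τ (.fixed η) z = glue Λ τ (.fixed η') z := fun e he z hz => by
    by_cases hzΛ : z ∈ Λ
    · exact hin z hzΛ
    · exact hbd z (mem_outerBoundary_of_mem_edgesTouching G' he hz hzΛ)
  have hE : ∑ e ∈ edgesTouching G' Λ, bondSpin (glue Λ τ (.fixed η)) e =
      ∑ e ∈ edgesTouching G' Λ, bondSpin (glue Λ τ (.fixed η')) e := by
    refine Finset.sum_congr rfl fun e he => ?_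
    induction e using Sym2.ind with
    | _ a b =>
      simp only [bondSpin_mk, spinAt, hpt _ he a (Sym2.mem_mk_left _ _),
        hpt _ he b (Sym2.mem_mk_right _ _)]
  have hF : ∑ x ∈ Λ, h x * spinAt x (glue Λ τ (.fixed η)) =
      ∑ x ∈ Λ, h x * spinAt x (glue Λ τ (.fixed η')) :=
    Finset.sum_congr rfl fun x hx => by simp only [spinAt, hin x hx]
  simp only [fieldWeight, fieldHamiltonian, interactionEdges_fixed, hE, hF]

/-- **Locality of `⟨F⟩^η_Λ` in the boundary condition** for observables depending on the spins in
`Λ`: the expectation depends on `η` only through `η|_{∂ᵉˣΛ}` (Friedli–Velenik 2017, §3.6.3,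
remark after eq. (3.26)); site-dependent-field version of the tree's
`isingExpect_fixed_congr_outerBoundary`. [cite: FriedliVelenik2017, §3.6.3, eq. (3.26)] -/
theorem _root_.Literature.Probability.LatticeModels.fieldExpect_fixed_congr_outerBoundary
    {Λ : Finset W} {η η' : SpinConfig W} (hη : ∀ y ∈ outerBoundary G' Λ, η y = η' y) (β : ℝ)
    (h : W → ℝ) {F : SpinConfig W → ℝ} (hFm : Measurable F)
    (hF : ∀ σ σ' : SpinConfig W, (∀ x ∈ Λ, σ x = σ' x) → F σ = F σ') :
    fieldExpect G' Λ β h (.fixed η) F = fieldExpect G' Λ β h (.fixed η') F := by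
  rw [fieldExpect_eq_sum_div G' Λ β h _ hFm, fieldExpect_eq_sum_div G' Λ β h _ hFm]
  have hZ : fieldZ G' Λ β h (.fixed η) = fieldZ G' Λ β h (.fixed η') :=
    Finset.sum_congr rfl fun τ _ => fieldWeight_fixed_congr_outerBoundary G' hη β h τ
  rw [hZ]
  congr 1
  refine Finset.sum_congr rfl fun τ _ => ?_
  rw [fieldWeight_fixed_congr_outerBoundary G' hη β h τ,
    hF _ (glue Λ τ (.fixed η')) fun x hx => by
      rw [glue_apply_of_mem _ _ _ hx, glue_apply_of_mem _ _ _ hx]]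

end Locality

/-! ### The neutralised field and the comparison of the two extremal systems with it -/

section Neutral

variable (d)

/-- The set of internal sites near the frozen core: those with a decimated neighbour `a` whose
image site `a/2` lies in `Λ'_R` (there the image spins are `±ω'_alt` in the two extremal
systems; footnote 48: "the internal spins … which feel a nonzero effective field; … we replace
these fields by zero"). A finite set (inside the cube `box d (2R+1)`).
[cite: VanenterFernandezSokal1993, §4.1.2 Step 3, footnote 48] -/
def nearSites (R : ℕ) : Finset (Site d) :=
  (box d (2 * R + 1)).filter fun k => ∃ a ∈ decNbrs d k, (fun j => a j / 2) ∈ box d R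

/-- **The neutralised field** `h⁰_R`: `2` at the internal sites coupled to two decimated spins
both of whose image sites lie OUTSIDE `Λ'_R` (where both extremal systems have `+` image spins),
`0` elsewhere — the common lower bound of the fields of the two extremal systems ("we replace
these fields by zero anyway", footnote 48). [cite: VanenterFernandezSokal1993, §4.1.2 Step 3, footnote 48] -/
def neutralField (R : ℕ) (k : Site d) : ℝ :=
  open Classical in
  if (decNbrs d k).Nonempty ∧ ∀ a ∈ decNbrs d k, (fun j => a j / 2) ∉ box d R then 2 else 0

variable {d}

/-- `0 ≤ h⁰_R ≤ 2`. [cite: VanenterFernandezSokal1993, §4.1.2 Step 3, footnote 48] -/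
theorem neutralField_nonneg (R : ℕ) (k : Site d) : 0 ≤ neutralField d R k := by
  unfold neutralField; split_ifs <;> norm_num

/-- A decimated neighbour of a site of the cube `box d (2R')` has its image site in `Λ'_{R'}`.
[cite: VanenterFernandezSokal1993, §4.3.1 Step 2] -/
theorem ediv_mem_box_of_mem_decNbrs {R' : ℕ} {k a : Site d} (hk : k ∈ box d (2 * R'))
    (ha : a ∈ decNbrs d k) : (fun j => a j / 2) ∈ box d R' := by
  obtain ⟨hadj, hdec⟩ := (mem_decNbrs d).1 ha
  rw [mem_box] at hk ⊢
  obtain ⟨i, hi⟩ := (zdGraph_adj_iff k a).1 hadj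
  intro j
  obtain ⟨m, hm⟩ := hdec j
  have hkj := hk j
  have haj : a j = k j + (Pi.single i (1 : ℤ) : Site d) j ∨ a j = k j - (Pi.single i (1 : ℤ) : Site d) j := by
    rcases hi with h | h
    · left; have := congrFun h j; simpa using this
    · right; have := congrFun h j; simp only [Pi.add_apply] at this; linarith
  have hs : (Pi.single i (1 : ℤ) : Site d) j = 0 ∨ (Pi.single i (1 : ℤ) : Site d) j = 1 := by
    by_cases hji : j = i
    · subst hji; simp
    · simp [Pi.single_eq_of_ne hji]
  rw [hm, Int.mul_ediv_cancel_left _ two_ne_zero]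
  rcases haj with h | h <;> rcases hs with h' | h' <;> rw [h'] at h <;> constructor <;> omega

/-- The value of the extremal boundary condition at a decimated site, through its image site.
[cite: VanenterFernandezSokal1993, §4.3.1 Step 2, eqs. (4.26)–(4.27)] -/
theorem coreAnnulusBC_apply_dec (R R' : ℕ) (s_ann s_out : ℤˣ) {a : Site d}
    (ha : IsDecimatedSite d a) :
    coreAnnulusBC d 2 R R' s_ann s_out a =
      open Classical in
      if (fun j => a j / 2) ∈ box d R then altConfig d (fun j => a j / 2)
      else if (fun j => a j / 2) ∈ box d R' then s_ann else s_out := by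
  have := coreAnnulusBC_apply_image (d := d) (b := 2) (by norm_num) R R' s_ann s_out (fun j => a j / 2)
  rwa [double_ediv_of_isDecimatedSite ha] at this

/-- **The alternating fields cancel; the annulus fields are nonnegative** (§4.1.2 Step 1: "each
internal spin is adjacent either to two image spins of opposite sign — in which case the
effective magnetic fields cancel — or else to no image spin"; Step 2: the internal spins near
the annulus feel nonnegative fields): at every internal site of the cube `box d (2R')` the field of
the extremal configuration with `+` annulus and core image spins `ε·ω'_alt` (`ε = ±1`) is at
least the neutralised field, in particular nonnegative.
[cite: VanenterFernandezSokal1993, §4.1.2 Steps 1–2 and footnote 48] -/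
theorem neutralField_le_decField {R R' : ℕ} {ξ : SpinConfig (Site d)} (ε : ℤˣ)
    (hcore : ∀ a, IsDecimatedSite d a → (fun j => a j / 2) ∈ box d R →
      ξ a = ε * altConfig d (fun j => a j / 2))
    (hann : ∀ a, IsDecimatedSite d a → (fun j => a j / 2) ∉ box d R →
      (fun j => a j / 2) ∈ box d R' → ξ a = 1)
    {k : Site d} (hk : ¬ IsDecimatedSite d k) (hkbox : k ∈ box d (2 * R')) :
    neutralField d R k ≤ decField d ξ k := by
  classical
  rcases decNbrs_eq_empty_or_pair hk with hempty | ⟨i, hdm, hdp, hpair⟩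
  · -- no decimated neighbour: both sides vanish
    have h0 : neutralField d R k = 0 := by
      unfold neutralField
      rw [if_neg]
      rintro ⟨hne, -⟩
      rw [hempty] at hne
      exact Finset.not_nonempty_empty hne
    rw [h0, decField, hempty, Finset.sum_empty]
  · -- the two decimated neighbours `a = k - eᵢ`, `b = k + eᵢ`, with `b/2 = a/2 + eᵢ`
    set a := k - Pi.single i 1 with hadef
    set b := k + Pi.single i 1 with hbdef
    have hab : a ≠ b := sub_single_ne_add_single k i
    have haN : a ∈ decNbrs d k := by rw [hpair]; simp
    have hbN : b ∈ decNbrs d k := by rw [hpair]; simp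
    have haR' : (fun j => a j / 2) ∈ box d R' := ediv_mem_box_of_mem_decNbrs hkbox haN
    have hbR' : (fun j => b j / 2) ∈ box d R' := ediv_mem_box_of_mem_decNbrs hkbox hbN
    have hhalf : (fun j => b j / 2) = (fun j => a j / 2) + Pi.single i 1 := ediv_add_single hdm
    have hdecF : decField d ξ k = spinAt a ξ + spinAt b ξ := by
      rw [decField, hpair, Finset.sum_pair hab]
    -- the values `ξ a`, `ξ b` as reals are `≥ -1`, and `= 1` off the core
    have hval : ∀ c, IsDecimatedSite d c → (fun j => c j / 2) ∈ box d R' →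
        ((fun j => c j / 2) ∈ box d R → spinAt c ξ = ε * (((altConfig d (fun j => c j / 2) : ℤˣ) : ℤ) : ℝ)) ∧
        ((fun j => c j / 2) ∉ box d R → spinAt c ξ = 1) := by
      intro c hc hcR'
      refine ⟨fun hcR => ?_, fun hcR => ?_⟩
      · rw [spinAt, hcore c hc hcR]; push_cast; ring
      · rw [spinAt, hann c hc hcR hcR']; simp
    have hεsq : ((ε : ℤ) : ℝ) * ((ε : ℤ) : ℝ) = 1 := by
      rcases Int.units_eq_one_or ε with h | h <;> simp [h]
    have haltb : (((altConfig d (fun j => b j / 2) : ℤˣ) : ℤ) : ℝ) =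
        -(((altConfig d (fun j => a j / 2) : ℤˣ) : ℤ) : ℝ) := by
      rw [hhalf, altConfig_add_single]; push_cast; ring
    have halt1 : (((altConfig d (fun j => a j / 2) : ℤˣ) : ℤ) : ℝ) = 1 ∨
        (((altConfig d (fun j => a j / 2) : ℤˣ) : ℤ) : ℝ) = -1 := by
      rcases Int.units_eq_one_or (altConfig d (fun j => a j / 2)) with h | h <;> simp [h]
    have hε1 : ((ε : ℤ) : ℝ) = 1 ∨ ((ε : ℤ) : ℝ) = -1 := by
      rcases Int.units_eq_one_or ε with h | h <;> simp [h]
    obtain ⟨haC, haA⟩ := hval a hdm haR'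
    obtain ⟨hbC, hbA⟩ := hval b hdp hbR'
    rw [hdecF]
    unfold neutralField
    by_cases hfar : (decNbrs d k).Nonempty ∧ ∀ c ∈ decNbrs d k, (fun j => c j / 2) ∉ box d R
    · rw [if_pos hfar, haA (hfar.2 a haN), hbA (hfar.2 b hbN)]; norm_num
    · rw [if_neg hfar]
      by_cases haR : (fun j => a j / 2) ∈ box d R <;> by_cases hbR : (fun j => b j / 2) ∈ box d R
      · rw [haC haR, hbC hbR, haltb]; linarith
      · rw [haC haR, hbA hbR]
        rcases halt1 with h | h <;> rcases hε1 with h' | h' <;> rw [h, h'] <;> norm_num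
      · rw [haA haR, hbC hbR, haltb]
        rcases halt1 with h | h <;> rcases hε1 with h' | h' <;> rw [h, h'] <;> norm_num
      · rw [haA haR, hbA hbR]; norm_num

/-- The field of the extremal `+`-annulus condition `ξ₊ = coreAnnulusBC d 2 R R' 1 (-1)` dominates
the neutralised field on the internal volume. [cite: VanenterFernandezSokal1993, §4.1.2 Steps 1–3 and eq. (4.26)] -/
theorem neutralField_le_decField_plus (R R' : ℕ) {k : Site d}
    (hk : k ∈ gpiVolume' d R') :
    neutralField d R k ≤ decField d (coreAnnulusBC d 2 R R' 1 (-1)) k := by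
  classical
  refine neutralField_le_decField 1 (fun a ha haR => ?_) (fun a ha haR haR' => ?_)
    (not_isDecimatedSite_of_mem_gpiVolume' hk) (mem_box_of_mem_gpiVolume' hk)
  · rw [coreAnnulusBC_apply_dec R R' 1 (-1) ha, if_pos haR, one_mul]
  · rw [coreAnnulusBC_apply_dec R R' 1 (-1) ha, if_neg haR, if_pos haR']

/-- The field of the flipped extremal `-`-annulus condition `ξ₋ = -coreAnnulusBC d 2 R R' (-1) 1`
(core image spins `-ω'_alt`, annulus `+`) dominates the neutralised field on the internal volume.
[cite: VanenterFernandezSokal1993, §4.1.2 Steps 1–3, eq. (4.27) and footnote 48] -/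
theorem neutralField_le_decField_minus (R R' : ℕ) {k : Site d}
    (hk : k ∈ gpiVolume' d R') :
    neutralField d R k ≤ decField d (-coreAnnulusBC d 2 R R' (-1) 1) k := by
  classical
  refine neutralField_le_decField (-1) (fun a ha haR => ?_) (fun a ha haR haR' => ?_)
    (not_isDecimatedSite_of_mem_gpiVolume' hk) (mem_box_of_mem_gpiVolume' hk)
  · rw [Pi.neg_apply, coreAnnulusBC_apply_dec R R' (-1) 1 ha, if_pos haR, neg_one_mul]
  · rw [Pi.neg_apply, coreAnnulusBC_apply_dec R R' (-1) 1 ha, if_neg haR, if_pos haR', neg_neg]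

/-- The two extremal boundary conditions are `-1` at every internal site (their value off the
image lattice is the "exterior" value), so on the diluted graph — whose neighbourhoods consist
of internal sites — they act as the `-` boundary condition.
[cite: VanenterFernandezSokal1993, §4.3.1 Step 2, eqs. (4.26)–(4.27)] -/
theorem outerBoundary_dilutedGraph_internal {Λ : Finset (Site d)} {y : Site d}
    (hy : y ∈ outerBoundary (dilutedGraph d) Λ) : ¬ IsDecimatedSite d y := by
  obtain ⟨-, x, -, hxy⟩ := mem_outerBoundary_iff.1 hy
  exact hxy.2.1

/-- On internal sites, `coreAnnulusBC d 2 R R' s_ann s_out = s_out`. [cite: VanenterFernandezSokal1993, §4.3.1 Step 2] -/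
theorem coreAnnulusBC_apply_internal (R R' : ℕ) (s_ann s_out : ℤˣ) {y : Site d}
    (hy : ¬ IsDecimatedSite d y) : coreAnnulusBC d 2 R R' s_ann s_out y = s_out := by
  classical
  unfold coreAnnulusBC
  have : ¬ ((∀ i, ((2 : ℕ) : ℤ) ∣ y i) ∧ (fun i => y i / (2 : ℕ)) ∈ box d R) := fun h => hy (by
    intro i; simpa using h.1 i)
  have h' : ¬ ((∀ i, ((2 : ℕ) : ℤ) ∣ y i) ∧ (fun i => y i / (2 : ℕ)) ∈ box d R') := fun h => hy (by
    intro i; simpa using h.1 i)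
  simp only [this, h', if_false]

/-- **The two expectations of `VEFS1993_eq412` as expectations of the internal system with the
`-` boundary condition** (bridge + locality).
[cite: VanenterFernandezSokal1993, §4.1.2 Step 0 and §4.3.1 Steps 1–2] -/
theorem isingExpect_extremal_eq_fieldExpect_minus (β : ℝ) {R' : ℕ} {ξ : SpinConfig (Site d)}
    (hξ : ∀ y, ¬ IsDecimatedSite d y → ξ y = -1) {f : SpinConfig (Site d) → ℝ} (hf : Measurable f)
    (hfloc : ∀ σ σ' : SpinConfig (Site d), (∀ x ∈ gpiVolume' d R', σ x = σ' x) → f σ = f σ') :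
    isingExpect (zdGraph d) (gpiVolume' d R') β 0 (.fixed ξ) f =
      fieldExpect (dilutedGraph d) (gpiVolume' d R') β (decField d ξ) .minus f := by
  rw [isingExpect_fixed_eq_fieldExpect_diluted (fun x hx => not_isDecimatedSite_of_mem_gpiVolume' hx) β ξ hf]
  exact fieldExpect_fixed_congr_outerBoundary (dilutedGraph d)
    (fun y hy => hξ y (outerBoundary_dilutedGraph_internal hy)) β _ hf hfloc

/-- The neighbour spin sum at the origin reads only internal sites of the volume (`R' ≥ 1`).
[cite: VanenterFernandezSokal1993, §4.1.2 Step 3] -/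
theorem nbrSpinSum_zero_congr {R' : ℕ} (hR' : 1 ≤ R') {σ σ' : SpinConfig (Site d)}
    (h : ∀ x ∈ gpiVolume' d R', σ x = σ' x) :
    nbrSpinSum (zdGraph d) 0 σ = nbrSpinSum (zdGraph d) 0 σ' := by
  unfold nbrSpinSum
  refine Finset.sum_congr rfl fun y hy => ?_
  rw [spinAt, spinAt, h y (mem_gpiVolume'_of_adj_zero hR' ((SimpleGraph.mem_neighborFinset _ _ _).1 hy))]

/-- **Comparison of the two extremal systems with the neutralised `-` system** (the FKG
monotonicity in the field, "we replace these fields by zero anyway", footnote 48): for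
`R < R'`,
`y - x ≥ ⟨e^{2β∑σ} - e^{-2β∑σ}⟩^{-}_{dilutedGraph; Λ^int_{R'}; β, h⁰_R}` where `x, y` are the two
expectations of `VEFS1993_eq412`. [cite: VanenterFernandezSokal1993, §4.1.2 Step 3 eqs. (4.9)–(4.12) and footnote 48] -/
theorem eq412_gap_ge_neutral {β : ℝ} (hβ : 0 ≤ β) {R R' : ℕ} (hRR' : R < R') :
    fieldExpect (dilutedGraph d) (gpiVolume' d R') β (neutralField d R) .minus
        (fun σ => Real.exp (2 * β * nbrSpinSum (zdGraph d) 0 σ) -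
          Real.exp (-(2 * β * nbrSpinSum (zdGraph d) 0 σ))) ≤
      isingExpect (zdGraph d) (gpiVolume' d R') β 0 (.fixed (-coreAnnulusBC d 2 R R' (-1) 1))
          (fun σ => Real.exp (2 * β * nbrSpinSum (zdGraph d) 0 σ)) -
        isingExpect (zdGraph d) (gpiVolume' d R') β 0 (.fixed (coreAnnulusBC d 2 R R' 1 (-1)))
          (fun σ => Real.exp (-(2 * β * nbrSpinSum (zdGraph d) 0 σ))) := by
  have hR'1 : 1 ≤ R' := by omega
  have hmP : Measurable fun σ : SpinConfig (Site d) => Real.exp (2 * β * nbrSpinSum (zdGraph d) 0 σ) :=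
    Real.measurable_exp.comp ((measurable_nbrSpinSum (zdGraph d) 0).const_mul _)
  have hmM : Measurable fun σ : SpinConfig (Site d) => Real.exp (-(2 * β * nbrSpinSum (zdGraph d) 0 σ)) :=
    Real.measurable_exp.comp ((measurable_nbrSpinSum (zdGraph d) 0).const_mul _).neg
  have hlocP : ∀ σ σ' : SpinConfig (Site d), (∀ x ∈ gpiVolume' d R', σ x = σ' x) →
      Real.exp (2 * β * nbrSpinSum (zdGraph d) 0 σ) = Real.exp (2 * β * nbrSpinSum (zdGraph d) 0 σ') :=
    fun σ σ' h => by rw [nbrSpinSum_zero_congr hR'1 h]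
  have hlocM : ∀ σ σ' : SpinConfig (Site d), (∀ x ∈ gpiVolume' d R', σ x = σ' x) →
      Real.exp (-(2 * β * nbrSpinSum (zdGraph d) 0 σ)) = Real.exp (-(2 * β * nbrSpinSum (zdGraph d) 0 σ')) :=
    fun σ σ' h => by rw [nbrSpinSum_zero_congr hR'1 h]
  -- both extremal conditions are `-1` on internal sites
  have hξP : ∀ y, ¬ IsDecimatedSite d y → (-coreAnnulusBC d 2 R R' (-1) 1) y = -1 := fun y hy => by
    rw [Pi.neg_apply, coreAnnulusBC_apply_internal R R' (-1) 1 hy]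
  have hξM : ∀ y, ¬ IsDecimatedSite d y → (coreAnnulusBC d 2 R R' 1 (-1)) y = -1 := fun y hy =>
    coreAnnulusBC_apply_internal R R' 1 (-1) hy
  rw [isingExpect_extremal_eq_fieldExpect_minus β hξP hmP hlocP,
    isingExpect_extremal_eq_fieldExpect_minus β hξM hmM hlocM,
    fieldExpect_sub (dilutedGraph d) _ β _ _ hmP hmM]
  -- FKG monotonicity in the field: `e^{2β∑}` is nondecreasing, `-e^{-2β∑}` is nondecreasing
  have hmonoP : Monotone fun σ : SpinConfig (Site d) => Real.exp (2 * β * nbrSpinSum (zdGraph d) 0 σ) :=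
    fun σ σ' h => Real.exp_le_exp.2 (mul_le_mul_of_nonneg_left (nbrSpinSum_mono (zdGraph d) 0 h)
      (by positivity))
  have hmonoM : Monotone fun σ : SpinConfig (Site d) => -Real.exp (-(2 * β * nbrSpinSum (zdGraph d) 0 σ)) :=
    fun σ σ' h => neg_le_neg (Real.exp_le_exp.2 (neg_le_neg (mul_le_mul_of_nonneg_left
      (nbrSpinSum_mono (zdGraph d) 0 h) (by positivity))))
  have h1 := fieldExpect_mono_field (dilutedGraph d) hβ (Λ := gpiVolume' d R')
    (fun k hk => neutralField_le_decField_minus R R' hk) .minus hmonoP hmP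
  have h2 := fieldExpect_mono_field (dilutedGraph d) hβ (Λ := gpiVolume' d R')
    (fun k hk => neutralField_le_decField_plus R R' hk) .minus hmonoM hmM.neg
  have e1 : fieldExpect (dilutedGraph d) (gpiVolume' d R') β (decField d (coreAnnulusBC d 2 R R' 1 (-1))) .minus
      (fun σ => -Real.exp (-(2 * β * nbrSpinSum (zdGraph d) 0 σ))) =
      -fieldExpect (dilutedGraph d) (gpiVolume' d R') β (decField d (coreAnnulusBC d 2 R R' 1 (-1))) .minus
        (fun σ => Real.exp (-(2 * β * nbrSpinSum (zdGraph d) 0 σ))) := by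
    have := fieldExpect_const_mul (dilutedGraph d) (gpiVolume' d R') β
      (decField d (coreAnnulusBC d 2 R R' 1 (-1))) .minus (-1) hmM
    simpa only [neg_one_mul] using this
  have e2 : fieldExpect (dilutedGraph d) (gpiVolume' d R') β (neutralField d R) .minus
      (fun σ => -Real.exp (-(2 * β * nbrSpinSum (zdGraph d) 0 σ))) =
      -fieldExpect (dilutedGraph d) (gpiVolume' d R') β (neutralField d R) .minus
        (fun σ => Real.exp (-(2 * β * nbrSpinSum (zdGraph d) 0 σ))) := by
    have := fieldExpect_const_mul (dilutedGraph d) (gpiVolume' d R') β (neutralField d R) .minus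
      (-1) hmM
    simpa only [neg_one_mul] using this
  rw [e1, e2] at h2
  linarith

end Neutral

end Literature.Barriers.CriticalPhenomena.NonGibbs

end
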